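import Mathlib
import Literature.Combinatorics.Additive.TripleProductProperty
import Summits.MatrixMultiplication.MatrixMultiplication.Theorems.GradedDesignFamily.Negative.DetSpread
import Summits.MatrixMultiplication.MatrixMultiplication.Theorems.GradedDesignFamily.Negative.SubfieldCellUnipotent

/-!
# The SLICED ENDGAME (E1) of THEOREM F′ for S3, proved
# (crux `LevelGradedCohnUmans.GradedDesignFamily`, stmt-MatrixMultiplication-7610; negative side,
# line `quadratic-extension-level-one-cell`, unit b2b-lgcu-subfield gen 18)

HONEST FRAMING.  This discharges hypothesis (E1) of `footprintExpansion_of_structure`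
(`Negative/SubfieldCellExpansion.lean`): a TPP triple `(φ(SL₂ k), Y, Z)` in `GL₂(K)`, `|K| = |k|²`,
with `|φ(SL₂ k)|, |Y|, |Z| ≥ c|K|^{3/2}`, cannot have at most `m` determinant values on `Y` and on
`Z` once `|K| > 9m⁴/c⁶`.  Proof: `det ∘ φ = 1` (`subfieldCell_det_eq_one`), the determinant-spread
cap `detSpread_card_mul_le` (`|X||Y||Z| ≤ #det(Y)·#det(Z)·(√2|SL₂K|^{3/2}/√(|K|−1) + |SL₂K|)`),
`|SL₂(K)| ≤ |K|³` (`card_specialLinearGroup_fin_two_le`, an explicit injection into `K³`), and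
arithmetic.  The remaining hypotheses (T), (S), (E2) of the composition are untouched.  A certificate
on the NEGATIVE side of the design stub S3; NOT summit progress.

Sorry-free. [folklore]
-/

set_option linter.dupNamespace false

noncomputable section

open scoped BigOperators Pointwise

namespace Summit.MatrixMultiplication.MatrixMultiplication.Theorems.GradedDesignFamily.Negative

/-- `|SL₂(K)| ≤ |K|³`: `s ↦ (s₀₀, s₁₀, s₀₁ or s₁₁)` (second entry of the row through the non-zero
entry of the first column) is injective. [folklore] -/
theorem card_specialLinearGroup_fin_two_le (K : Type) [Field K] [Fintype K] [DecidableEq K] :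
    Fintype.card (Matrix.SpecialLinearGroup (Fin 2) K) ≤ Fintype.card K ^ 3 := by
  let f : Matrix.SpecialLinearGroup (Fin 2) K → K × K × K := fun s =>
    ((s : Matrix (Fin 2) (Fin 2) K) 0 0, (s : Matrix (Fin 2) (Fin 2) K) 1 0,
      if (s : Matrix (Fin 2) (Fin 2) K) 0 0 = 0 then (s : Matrix (Fin 2) (Fin 2) K) 1 1
      else (s : Matrix (Fin 2) (Fin 2) K) 0 1)
  have hf : Function.Injective f := by
    intro s t h
    simp only [f, Prod.mk.injEq] at h
    obtain ⟨h00, h10, h3⟩ := h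
    have hs : (s : Matrix (Fin 2) (Fin 2) K) 0 0 * (s : Matrix (Fin 2) (Fin 2) K) 1 1 -
        (s : Matrix (Fin 2) (Fin 2) K) 0 1 * (s : Matrix (Fin 2) (Fin 2) K) 1 0 = 1 := by
      rw [← Matrix.det_fin_two]; exact s.2
    have ht : (t : Matrix (Fin 2) (Fin 2) K) 0 0 * (t : Matrix (Fin 2) (Fin 2) K) 1 1 -
        (t : Matrix (Fin 2) (Fin 2) K) 0 1 * (t : Matrix (Fin 2) (Fin 2) K) 1 0 = 1 := by
      rw [← Matrix.det_fin_two]; exact t.2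
    have h01_11 : (s : Matrix (Fin 2) (Fin 2) K) 0 1 = (t : Matrix (Fin 2) (Fin 2) K) 0 1 ∧
        (s : Matrix (Fin 2) (Fin 2) K) 1 1 = (t : Matrix (Fin 2) (Fin 2) K) 1 1 := by
      by_cases h0 : (s : Matrix (Fin 2) (Fin 2) K) 0 0 = 0
      · have h0' : (t : Matrix (Fin 2) (Fin 2) K) 0 0 = 0 := h00 ▸ h0
        rw [if_pos h0, if_pos h0'] at h3
        refine ⟨?_, h3⟩
        rw [h0, zero_mul, zero_sub] at hs
        rw [h0', zero_mul, zero_sub] at ht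
        have h10ne : (s : Matrix (Fin 2) (Fin 2) K) 1 0 ≠ 0 := by
          intro hz; rw [hz, mul_zero, neg_zero] at hs; exact zero_ne_one hs
        apply mul_right_cancel₀ h10ne
        have := hs.trans ht.symm
        rw [← h10] at this
        exact neg_injective this
      · have h0' : ¬ (t : Matrix (Fin 2) (Fin 2) K) 0 0 = 0 := h00 ▸ h0
        rw [if_neg h0, if_neg h0'] at h3
        refine ⟨h3, ?_⟩
        apply mul_left_cancel₀ h0
        have := hs.trans ht.symm
        rw [← h00, ← h10, ← h3] at this
        linear_combination this
    apply Matrix.SpecialLinearGroup.ext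
    intro i j
    fin_cases i <;> fin_cases j
    · exact h00
    · exact h01_11.1
    · exact h10
    · exact h01_11.2
  have := Fintype.card_le_of_injective f hf
  simpa [Fintype.card_prod, pow_succ, mul_assoc] using this

/-- **(E1) SLICED ENDGAME, proved.**  The statement is hypothesis (E1) of
`footprintExpansion_of_structure`, verbatim.  NOT summit progress. [folklore] -/
theorem subfieldCell_slicedEndgame :
    ∀ c : ℝ, 0 < c → ∀ m : ℕ, ∃ Q₃ : ℕ, ∀ (k K : Type) [Field k] [Fintype k] [DecidableEq k]
      [Field K] [Fintype K] [DecidableEq K]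
      (φ : Matrix.SpecialLinearGroup (Fin 2) k →* Matrix.GeneralLinearGroup (Fin 2) K),
      Function.Injective φ → Fintype.card K = Fintype.card k ^ 2 → Q₃ ≤ Fintype.card K →
      ∀ Y Z : Finset (Matrix.GeneralLinearGroup (Fin 2) K),
        c * (Fintype.card K : ℝ) ^ (3 / 2 : ℝ) ≤ (Finset.univ.image φ).card →
        c * (Fintype.card K : ℝ) ^ (3 / 2 : ℝ) ≤ Y.card →
        c * (Fintype.card K : ℝ) ^ (3 / 2 : ℝ) ≤ Z.card →
        Literature.Combinatorics.Additive.TripleProductProperty (Finset.univ.image φ) Y Z →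
        (Y.image Matrix.GeneralLinearGroup.det).card ≤ m →
        (Z.image Matrix.GeneralLinearGroup.det).card ≤ m → False := by
  intro c hc m
  refine ⟨⌊9 * (m : ℝ) ^ 4 / c ^ 6⌋₊ + 1, ?_⟩
  intro k K _ _ _ _ _ _ φ _hφ hK hQ Y Z hH hY hZ htpp hYd hZd
  -- notation-free abbreviations
  have hQ2 : (2 : ℝ) ≤ (Fintype.card K : ℝ) := by exact_mod_cast Fintype.one_lt_card
  have hQ0 : (0 : ℝ) < (Fintype.card K : ℝ) := by linarith
  have hbig : 9 * (m : ℝ) ^ 4 / c ^ 6 < (Fintype.card K : ℝ) :=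
    (Nat.lt_floor_add_one _).trans_le (by exact_mod_cast hQ)
  -- `s = Q^{3/2} = Q √Q`
  have hs : (Fintype.card K : ℝ) ^ (3 / 2 : ℝ) = (Fintype.card K : ℝ) * Real.sqrt (Fintype.card K) := by
    rw [show (3 / 2 : ℝ) = 1 + 1 / 2 by norm_num, Real.rpow_add hQ0, Real.rpow_one,
      Real.sqrt_eq_rpow]
  have hsq0 : (0 : ℝ) < Real.sqrt (Fintype.card K) := Real.sqrt_pos.2 hQ0
  have hspos : (0 : ℝ) < (Fintype.card K : ℝ) ^ (3 / 2 : ℝ) := Real.rpow_pos_of_pos hQ0 _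
  -- `det ∘ φ = 1`
  have hX : ∀ x ∈ Finset.univ.image φ, Matrix.GeneralLinearGroup.det x = 1 := by
    intro x hx
    obtain ⟨a, -, rfl⟩ := Finset.mem_image.1 hx
    apply Units.val_eq_one.1
    rw [Matrix.GeneralLinearGroup.val_det_apply]
    exact subfieldCell_det_eq_one φ hK a
  -- the determinant-spread cap
  have hcap := detSpread_card_mul_le (Finset.univ.image φ) Y Z htpp hX
  -- `|SL₂(K)| ≤ Q³`, hence the cap is `≤ m² (2 Q⁴ + Q³) ≤ 3 m² Q⁴`
  have hSL : (Fintype.card (Matrix.SpecialLinearGroup (Fin 2) K) : ℝ) ≤ (Fintype.card K : ℝ) ^ 3 := by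
    exact_mod_cast card_specialLinearGroup_fin_two_le K
  have hSL0 : (0 : ℝ) ≤ (Fintype.card (Matrix.SpecialLinearGroup (Fin 2) K) : ℝ) := Nat.cast_nonneg _
  have hSL32 : (Fintype.card (Matrix.SpecialLinearGroup (Fin 2) K) : ℝ) ^ (3 / 2 : ℝ) ≤
      (Fintype.card K : ℝ) ^ 4 * Real.sqrt (Fintype.card K) := by
    calc (Fintype.card (Matrix.SpecialLinearGroup (Fin 2) K) : ℝ) ^ (3 / 2 : ℝ)
        ≤ ((Fintype.card K : ℝ) ^ 3) ^ (3 / 2 : ℝ) :=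
          Real.rpow_le_rpow hSL0 hSL (by norm_num)
      _ = ((Fintype.card K : ℝ) ^ (3 / 2 : ℝ)) ^ 3 := by
          rw [← Real.rpow_natCast ((Fintype.card K : ℝ)) 3, ← Real.rpow_mul hQ0.le,
            ← Real.rpow_natCast ((Fintype.card K : ℝ) ^ (3 / 2 : ℝ)) 3, ← Real.rpow_mul hQ0.le]
          norm_num
      _ = (Fintype.card K : ℝ) ^ 4 * Real.sqrt (Fintype.card K) := by
          rw [hs]
          have h2 : Real.sqrt (Fintype.card K : ℝ) ^ 2 = Fintype.card K := Real.sq_sqrt hQ0.le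
          calc ((Fintype.card K : ℝ) * Real.sqrt (Fintype.card K)) ^ 3
              = (Fintype.card K : ℝ) ^ 3 * Real.sqrt (Fintype.card K) ^ 2 *
                  Real.sqrt (Fintype.card K) := by ring
            _ = (Fintype.card K : ℝ) ^ 4 * Real.sqrt (Fintype.card K) := by rw [h2]; ring
  have hroot : Real.sqrt 2 * Real.sqrt (Fintype.card K) ≤ 2 * Real.sqrt ((Fintype.card K : ℝ) - 1) := by
    rw [← Real.sqrt_mul (by norm_num : (0 : ℝ) ≤ 2),
      show (2 : ℝ) = Real.sqrt 4 by rw [show (4 : ℝ) = 2 ^ 2 by norm_num, Real.sqrt_sq (by norm_num)],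
      ← Real.sqrt_mul (by norm_num : (0 : ℝ) ≤ 4)]
    exact Real.sqrt_le_sqrt (by rw [show Real.sqrt 4 = (2 : ℝ) by
      rw [show (4 : ℝ) = 2 ^ 2 by norm_num, Real.sqrt_sq (by norm_num)]]; linarith)
  have hQm1 : (0 : ℝ) < Real.sqrt ((Fintype.card K : ℝ) - 1) := Real.sqrt_pos.2 (by linarith)
  have hterm : Real.sqrt 2 * (Fintype.card (Matrix.SpecialLinearGroup (Fin 2) K) : ℝ) ^ (3 / 2 : ℝ) /
      Real.sqrt ((Fintype.card K : ℝ) - 1) ≤ 2 * (Fintype.card K : ℝ) ^ 4 := by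
    rw [div_le_iff₀ hQm1]
    calc Real.sqrt 2 * (Fintype.card (Matrix.SpecialLinearGroup (Fin 2) K) : ℝ) ^ (3 / 2 : ℝ)
        ≤ Real.sqrt 2 * ((Fintype.card K : ℝ) ^ 4 * Real.sqrt (Fintype.card K)) :=
          mul_le_mul_of_nonneg_left hSL32 (Real.sqrt_nonneg _)
      _ = (Fintype.card K : ℝ) ^ 4 * (Real.sqrt 2 * Real.sqrt (Fintype.card K)) := by ring
      _ ≤ (Fintype.card K : ℝ) ^ 4 * (2 * Real.sqrt ((Fintype.card K : ℝ) - 1)) :=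
          mul_le_mul_of_nonneg_left hroot (by positivity)
      _ = 2 * (Fintype.card K : ℝ) ^ 4 * Real.sqrt ((Fintype.card K : ℝ) - 1) := by ring
  have hcap' : Real.sqrt 2 * (Fintype.card (Matrix.SpecialLinearGroup (Fin 2) K) : ℝ) ^ (3 / 2 : ℝ) /
      Real.sqrt ((Fintype.card K : ℝ) - 1) + Fintype.card (Matrix.SpecialLinearGroup (Fin 2) K) ≤
      3 * (Fintype.card K : ℝ) ^ 4 := by
    have h3 : (Fintype.card K : ℝ) ^ 3 ≤ (Fintype.card K : ℝ) ^ 4 :=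
      pow_le_pow_right₀ (by linarith) (by norm_num)
    linarith
  -- lower bound `c³ Q⁴ √Q ≤ |H||Y||Z|`
  have h2sq : Real.sqrt (Fintype.card K : ℝ) ^ 2 = Fintype.card K := Real.sq_sqrt hQ0.le
  have hlow : c ^ 3 * (Fintype.card K : ℝ) ^ 4 * Real.sqrt (Fintype.card K) ≤
      (((Finset.univ.image φ).card * Y.card * Z.card : ℕ) : ℝ) := by
    push_cast
    have hcs : (0 : ℝ) ≤ c * (Fintype.card K : ℝ) ^ (3 / 2 : ℝ) := (mul_pos hc hspos).le
    have h1 : c * (Fintype.card K : ℝ) ^ (3 / 2 : ℝ) * (c * (Fintype.card K : ℝ) ^ (3 / 2 : ℝ)) ≤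
        ((Finset.univ.image φ).card : ℝ) * Y.card := mul_le_mul hH hY hcs (hcs.trans hH)
    have h2 : c * (Fintype.card K : ℝ) ^ (3 / 2 : ℝ) * (c * (Fintype.card K : ℝ) ^ (3 / 2 : ℝ)) *
        (c * (Fintype.card K : ℝ) ^ (3 / 2 : ℝ)) ≤
        ((Finset.univ.image φ).card : ℝ) * Y.card * Z.card := mul_le_mul h1 hZ hcs (by positivity)
    rw [hs] at h2
    have key : c * ((Fintype.card K : ℝ) * Real.sqrt (Fintype.card K)) *
        (c * ((Fintype.card K : ℝ) * Real.sqrt (Fintype.card K))) *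
        (c * ((Fintype.card K : ℝ) * Real.sqrt (Fintype.card K))) =
        c ^ 3 * (Fintype.card K : ℝ) ^ 4 * Real.sqrt (Fintype.card K) := by
      calc _ = c ^ 3 * (Fintype.card K : ℝ) ^ 3 * Real.sqrt (Fintype.card K) ^ 2 *
            Real.sqrt (Fintype.card K) := by ring
        _ = c ^ 3 * (Fintype.card K : ℝ) ^ 4 * Real.sqrt (Fintype.card K) := by rw [h2sq]; ring
    rw [key] at h2
    exact h2
  -- upper bound `|H||Y||Z| ≤ m² · 3 Q⁴`
  have hdd : (((Y.image Matrix.GeneralLinearGroup.det).card *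
      (Z.image Matrix.GeneralLinearGroup.det).card : ℕ) : ℝ) ≤ (m : ℝ) ^ 2 := by
    have := Nat.mul_le_mul hYd hZd
    calc (((Y.image Matrix.GeneralLinearGroup.det).card *
        (Z.image Matrix.GeneralLinearGroup.det).card : ℕ) : ℝ) ≤ ((m * m : ℕ) : ℝ) := by
          exact_mod_cast this
      _ = (m : ℝ) ^ 2 := by push_cast; ring
  have hcap0 : (0 : ℝ) ≤ Real.sqrt 2 * (Fintype.card (Matrix.SpecialLinearGroup (Fin 2) K) : ℝ) ^ (3 / 2 : ℝ) /
      Real.sqrt ((Fintype.card K : ℝ) - 1) + Fintype.card (Matrix.SpecialLinearGroup (Fin 2) K) := by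
    positivity
  have hup : (((Finset.univ.image φ).card * Y.card * Z.card : ℕ) : ℝ) ≤ (m : ℝ) ^ 2 * (3 * (Fintype.card K : ℝ) ^ 4) :=
    hcap.trans (mul_le_mul hdd hcap' hcap0 (by positivity))
  -- conclusion: `c³ √Q ≤ 3 m²`, i.e. `Q ≤ 9 m⁴ / c⁶`
  have hQ4 : (0 : ℝ) < (Fintype.card K : ℝ) ^ 4 := by positivity
  have hfin : c ^ 3 * Real.sqrt (Fintype.card K) ≤ 3 * (m : ℝ) ^ 2 := by
    have h := hlow.trans hup
    have h' : c ^ 3 * Real.sqrt (Fintype.card K) * (Fintype.card K : ℝ) ^ 4 ≤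
        3 * (m : ℝ) ^ 2 * (Fintype.card K : ℝ) ^ 4 := by
      calc c ^ 3 * Real.sqrt (Fintype.card K) * (Fintype.card K : ℝ) ^ 4
          = c ^ 3 * (Fintype.card K : ℝ) ^ 4 * Real.sqrt (Fintype.card K) := by ring
        _ ≤ (m : ℝ) ^ 2 * (3 * (Fintype.card K : ℝ) ^ 4) := h
        _ = 3 * (m : ℝ) ^ 2 * (Fintype.card K : ℝ) ^ 4 := by ring
    exact le_of_mul_le_mul_right h' hQ4
  have hc3 : (0 : ℝ) < c ^ 3 := pow_pos hc 3
  have hsqle : Real.sqrt (Fintype.card K : ℝ) ≤ 3 * (m : ℝ) ^ 2 / c ^ 3 := by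
    rw [le_div_iff₀ hc3]; linarith
  have hQle : (Fintype.card K : ℝ) ≤ 9 * (m : ℝ) ^ 4 / c ^ 6 := by
    have h0 : (0 : ℝ) ≤ 3 * (m : ℝ) ^ 2 / c ^ 3 := by positivity
    have := pow_le_pow_left₀ (Real.sqrt_nonneg _) hsqle 2
    rw [Real.sq_sqrt hQ0.le] at this
    calc (Fintype.card K : ℝ) ≤ (3 * (m : ℝ) ^ 2 / c ^ 3) ^ 2 := this
      _ = 9 * (m : ℝ) ^ 4 / c ^ 6 := by rw [div_pow]; ring
  linarith

end Summit.MatrixMultiplication.MatrixMultiplication.Theorems.GradedDesignFamily.Negative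

end
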